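import Literature.NumberTheory.Automorphic.UnitaryGroupCentralizerCovolSplit
import HarnessLib

/-!
# The (T′) covolume comparison REDUCES ALONG THE DOCKS: two adelic centralisers docked on product models with covolume-matched factors have
# equal covolume weights (Rogawski 1990 §3.8 Prop. 3.8.1 (a) p. 30 «`G_γ ≅ U(H_a) × U(H_b)`»; §14.5 Lemma 14.5.2 (b) pp. 238–239
# «`m(Z G′_{γ^δ}∖G′_{γ^δ}) = m(Z_H∖H)` for every `δ`»; Weil 1965 n° 53 (43) «`τ_λ(𝔤) = τ_λ(G)`», n° 54 p. 82: the Tamagawa number of `U(a₁,…,a_m)`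
# over a quadratic extension does not depend on the `a_i`)

Topic `NumberTheory/Automorphic`; namespace `Literature.NumberTheory.Automorphic.UnitaryGroup`.  THEOREMS ONLY (no definition, no instance, no notation,
no named fact, no `sorry`).  Cell `pub/hodgecm-mathlib`, crux H413 = stmt-HodgeConjecture-24833, half A line LH5 (closer stub `stub_S1finTFCovol`, letter ★
`Rogawski1990.TamagawaSingularMembersFinTFCovol`, conjunct (T′)); organ «R2J» (rank-2 reduction junction) of prover seat LH5-p03 (g0).  Count-neutral plumbing.
HONEST LABEL: HC_CM is proved only modulo the printed citations until rung 0 closes; this file computes no volume — it is the equality sign that carries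
a covolume identity for the RANK-2 blocks `U(H_a)`, `U(H_a′)` (print: [Weil1965 n° 54], [Kottwitz1988 Prop. 2]) and for the RANK-1 blocks `U(H_b)`, `U(H_b′)`
(both the norm-one torus `L¹`) up to the two docked adelic centralisers `Z(γ)`, `Z(γ′)` of (T′).

WHAT.  ★ `covol_centralizer_eq_mul_of_continuousMulEquiv_prod` («(K7-s)-SPLIT») splits ONE covolume weight along ONE dock
`e : U(H_a)(𝔸) × U(H_b)(𝔸) ≃ₜ* Z(γ)` (lattice clause `hΛe`, Haar matching `e_* (t_a ⊗ t_b) = νZ`).  (T′) compares TWO centralisers `Z(γ)`, `Z(γ′)`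
(`γ = γ_c ⊗ 1`, `γ′ = γ_{c′} ⊗ 1`, `c`, `c′` stably conjugate singular non-central), each with its own Rogawski frame, hence its own dock onto
`U(H_a)(𝔸) × U(H_b)(𝔸)` resp. `U(H_a′)(𝔸) × U(H_b′)(𝔸)` — DIFFERENT hermitian blocks in general (`W_c ≄ W_{c′}` as hermitian planes when `c`, `c′` are not
conjugate).  This file records the two-dock bookkeeping, every instance binder being the (K7-s) frame's or ★-dischargeable exactly as in ★ (K7-s)-SPLIT:

* `covol_centralizer_eq_of_docks` — if the rank-`N_a` covolumes agree (`covol(U(H_a); t_a) = covol(U(H_a′); t_a′)`) and the rank-`N_b` covolumes agree, the two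
  centraliser covolume weights agree (the direction (T′) consumes);
* `covol_centralizer_eq_iff_of_docks` — conversely, when the common rank-`N_b` covolume is neither `0` nor `∞`, the centraliser weights agree IFF the rank-`N_a`
  covolumes do (`ENNReal.mul_left_inj`);
* `covol_factor_eq_of_docks` — the same cancellation read the other way: equal centraliser weights and equal POSITIVE FINITE rank-`N_a` covolumes force equal
  rank-`N_b` covolumes.

## References
* [Rogawski1990] J. D. Rogawski, *Automorphic Representations of Unitary Groups in Three Variables*, Ann. of Math. Stud. 123 (1990), §3.8 Prop. 3.8.1 (a)
  p. 30; §14.5 Lemma 14.5.2 (b) pp. 238–239.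
* [Weil1965] A. Weil, *Sur la formule de Siegel dans la théorie des groupes classiques*, Acta Math. 113 (1965) 1–87, n° 53 eq. (43) p. 81, n° 54 p. 82.
* [Kottwitz1988] R. E. Kottwitz, *Tamagawa numbers*, Ann. of Math. (2) 127 (1988), Prop. 2.
* [Gelbart1975] S. Gelbart, *Automorphic forms on adele groups*, Ann. of Math. Stud. 83 (1975), Remark 9.23 p. 155.
-/

set_option autoImplicit false

noncomputable section

open MeasureTheory MeasureTheory.Measure Topology Set NumberField
open Literature.MeasureTheory.Group
open scoped ENNReal

namespace Literature.NumberTheory.Automorphic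

namespace UnitaryGroup

variable (L : Type) [Field L] [NumberField L] [IsCMField L]

section TwoDocks

variable {N Na Nb : ℕ} (H : Matrix (Fin N) (Fin N) L)
  (Ha : Matrix (Fin Na) (Fin Na) L) (Hb : Matrix (Fin Nb) (Fin Nb) L)
  (Ha' : Matrix (Fin Na) (Fin Na) L) (Hb' : Matrix (Fin Nb) (Fin Nb) L)
  [MeasurableSpace (cmDatum L N H).Adelic] [BorelSpace (cmDatum L N H).Adelic]
  [MeasurableSpace (cmDatum L Na Ha).Adelic] [BorelSpace (cmDatum L Na Ha).Adelic]
  [MeasurableSpace (cmDatum L Nb Hb).Adelic] [BorelSpace (cmDatum L Nb Hb).Adelic]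
  [MeasurableSpace (cmDatum L Na Ha').Adelic] [BorelSpace (cmDatum L Na Ha').Adelic]
  [MeasurableSpace (cmDatum L Nb Hb').Adelic] [BorelSpace (cmDatum L Nb Hb').Adelic]
  (γ γ' : (cmDatum L N H).Adelic)
  [MeasurableSpace ((cmDatum L Na Ha).Adelic ⧸ (cmDatum L Na Ha).quotientSubgroup)]
  [BorelSpace ((cmDatum L Na Ha).Adelic ⧸ (cmDatum L Na Ha).quotientSubgroup)]
  [MeasurableSpace ((cmDatum L Nb Hb).Adelic ⧸ (cmDatum L Nb Hb).quotientSubgroup)]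
  [BorelSpace ((cmDatum L Nb Hb).Adelic ⧸ (cmDatum L Nb Hb).quotientSubgroup)]
  [MeasurableSpace ((cmDatum L Na Ha').Adelic ⧸ (cmDatum L Na Ha').quotientSubgroup)]
  [BorelSpace ((cmDatum L Na Ha').Adelic ⧸ (cmDatum L Na Ha').quotientSubgroup)]
  [MeasurableSpace ((cmDatum L Nb Hb').Adelic ⧸ (cmDatum L Nb Hb').quotientSubgroup)]
  [BorelSpace ((cmDatum L Nb Hb').Adelic ⧸ (cmDatum L Nb Hb').quotientSubgroup)]
  [MeasurableSpace (↥(Subgroup.centralizer ({γ} : Set (cmDatum L N H).Adelic)) ⧸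
    ((cmDatum L N H).quotientSubgroup ⊓ Subgroup.centralizer ({γ} : Set (cmDatum L N H).Adelic)).subgroupOf
      (Subgroup.centralizer ({γ} : Set (cmDatum L N H).Adelic)))]
  [BorelSpace (↥(Subgroup.centralizer ({γ} : Set (cmDatum L N H).Adelic)) ⧸
    ((cmDatum L N H).quotientSubgroup ⊓ Subgroup.centralizer ({γ} : Set (cmDatum L N H).Adelic)).subgroupOf
      (Subgroup.centralizer ({γ} : Set (cmDatum L N H).Adelic)))]
  [MeasurableSpace (↥(Subgroup.centralizer ({γ'} : Set (cmDatum L N H).Adelic)) ⧸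
    ((cmDatum L N H).quotientSubgroup ⊓ Subgroup.centralizer ({γ'} : Set (cmDatum L N H).Adelic)).subgroupOf
      (Subgroup.centralizer ({γ'} : Set (cmDatum L N H).Adelic)))]
  [BorelSpace (↥(Subgroup.centralizer ({γ'} : Set (cmDatum L N H).Adelic)) ⧸
    ((cmDatum L N H).quotientSubgroup ⊓ Subgroup.centralizer ({γ'} : Set (cmDatum L N H).Adelic)).subgroupOf
      (Subgroup.centralizer ({γ'} : Set (cmDatum L N H).Adelic)))]
  -- the standing families of the (K7-s) ∕ (T′) frame (★ `TamagawaSingularMembersFinTFCovol` :80–:86): `Z(·)` closed, `count` on the lattices Haar — all ★-dischargeable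
  -- (★ `isClosed_centralizer_cmDatum`, ★ `isHaarMeasure_count_quotientSubgroup_inf_centralizer_subgroupOf`, ★ `isHaarMeasure_count_quotientSubgroup`)
  [hZ : IsClosed ((Subgroup.centralizer ({γ} : Set (cmDatum L N H).Adelic) : Subgroup (cmDatum L N H).Adelic) : Set (cmDatum L N H).Adelic)]
  [hZ' : IsClosed ((Subgroup.centralizer ({γ'} : Set (cmDatum L N H).Adelic) : Subgroup (cmDatum L N H).Adelic) : Set (cmDatum L N H).Adelic)]
  [(count : Measure ↥(((cmDatum L N H).quotientSubgroup ⊓ Subgroup.centralizer ({γ} : Set (cmDatum L N H).Adelic)).subgroupOf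
      (Subgroup.centralizer ({γ} : Set (cmDatum L N H).Adelic)))).IsHaarMeasure]
  [(count : Measure ↥(((cmDatum L N H).quotientSubgroup ⊓ Subgroup.centralizer ({γ'} : Set (cmDatum L N H).Adelic)).subgroupOf
      (Subgroup.centralizer ({γ'} : Set (cmDatum L N H).Adelic)))).IsHaarMeasure]
  [(count : Measure ↥(cmDatum L Na Ha).quotientSubgroup).IsHaarMeasure] [(count : Measure ↥(cmDatum L Nb Hb).quotientSubgroup).IsHaarMeasure]
  [(count : Measure ↥(cmDatum L Na Ha').quotientSubgroup).IsHaarMeasure] [(count : Measure ↥(cmDatum L Nb Hb').quotientSubgroup).IsHaarMeasure]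
  -- closedness of the lattices (proof terms are the caller's; matched by proof irrelevance)
  (hΛ : IsClosed ((((cmDatum L N H).quotientSubgroup ⊓ Subgroup.centralizer ({γ} : Set (cmDatum L N H).Adelic)).subgroupOf
    (Subgroup.centralizer ({γ} : Set (cmDatum L N H).Adelic)) :
      Subgroup ↥(Subgroup.centralizer ({γ} : Set (cmDatum L N H).Adelic))) : Set ↥(Subgroup.centralizer ({γ} : Set (cmDatum L N H).Adelic))))
  (hΛ' : IsClosed ((((cmDatum L N H).quotientSubgroup ⊓ Subgroup.centralizer ({γ'} : Set (cmDatum L N H).Adelic)).subgroupOf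
    (Subgroup.centralizer ({γ'} : Set (cmDatum L N H).Adelic)) :
      Subgroup ↥(Subgroup.centralizer ({γ'} : Set (cmDatum L N H).Adelic))) : Set ↥(Subgroup.centralizer ({γ'} : Set (cmDatum L N H).Adelic))))
  (hqa : IsClosed (((cmDatum L Na Ha).quotientSubgroup : Subgroup (cmDatum L Na Ha).Adelic) : Set (cmDatum L Na Ha).Adelic))
  (hqb : IsClosed (((cmDatum L Nb Hb).quotientSubgroup : Subgroup (cmDatum L Nb Hb).Adelic) : Set (cmDatum L Nb Hb).Adelic))
  (hqa' : IsClosed (((cmDatum L Na Ha').quotientSubgroup : Subgroup (cmDatum L Na Ha').Adelic) : Set (cmDatum L Na Ha').Adelic))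
  (hqb' : IsClosed (((cmDatum L Nb Hb').quotientSubgroup : Subgroup (cmDatum L Nb Hb').Adelic) : Set (cmDatum L Nb Hb').Adelic))
  -- the two docks with their lattice clauses (★ `exists_frame_continuousMulEquiv_centralizer_toAdelic_of_singular` supplies them at singular non-central rational classes)
  (e : ((cmDatum L Na Ha).Adelic × (cmDatum L Nb Hb).Adelic) ≃ₜ* ↥(Subgroup.centralizer ({γ} : Set (cmDatum L N H).Adelic)))
  (hΛe : ∀ u, e u ∈ ((cmDatum L N H).quotientSubgroup ⊓ Subgroup.centralizer ({γ} : Set (cmDatum L N H).Adelic)).subgroupOf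
      (Subgroup.centralizer ({γ} : Set (cmDatum L N H).Adelic)) ↔
    u ∈ ((cmDatum L Na Ha).quotientSubgroup).prod ((cmDatum L Nb Hb).quotientSubgroup))
  (e' : ((cmDatum L Na Ha').Adelic × (cmDatum L Nb Hb').Adelic) ≃ₜ* ↥(Subgroup.centralizer ({γ'} : Set (cmDatum L N H).Adelic)))
  (hΛe' : ∀ u, e' u ∈ ((cmDatum L N H).quotientSubgroup ⊓ Subgroup.centralizer ({γ'} : Set (cmDatum L N H).Adelic)).subgroupOf
      (Subgroup.centralizer ({γ'} : Set (cmDatum L N H).Adelic)) ↔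
    u ∈ ((cmDatum L Na Ha').quotientSubgroup).prod ((cmDatum L Nb Hb').quotientSubgroup))
  -- Haar data matched along the docks
  (ta : Measure (cmDatum L Na Ha).Adelic) [IsHaarMeasure ta] [ta.IsMulRightInvariant]
  (tb : Measure (cmDatum L Nb Hb).Adelic) [IsHaarMeasure tb] [tb.IsMulRightInvariant]
  (ta' : Measure (cmDatum L Na Ha').Adelic) [IsHaarMeasure ta'] [ta'.IsMulRightInvariant]
  (tb' : Measure (cmDatum L Nb Hb').Adelic) [IsHaarMeasure tb'] [tb'.IsMulRightInvariant]
  (νZ : Measure ↥(Subgroup.centralizer ({γ} : Set (cmDatum L N H).Adelic))) [IsHaarMeasure νZ] [νZ.IsMulRightInvariant]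
  (νZ' : Measure ↥(Subgroup.centralizer ({γ'} : Set (cmDatum L N H).Adelic))) [IsHaarMeasure νZ'] [νZ'.IsMulRightInvariant]
  (hν : Measure.map e (ta.prod tb) = νZ) (hν' : Measure.map e' (ta'.prod tb') = νZ')

include hqa hqb hqa' hqb' hΛe hΛe' hν hν' in
/-- **(T′) ALONG THE DOCKS, the direction (T′) consumes.**  Two adelic centralisers `Z(γ)`, `Z(γ′)` in `U(H)(𝔸_{L⁺})`, docked on product models
`e : U(H_a)(𝔸) × U(H_b)(𝔸) ≃ₜ* Z(γ)`, `e′ : U(H_a′)(𝔸) × U(H_b′)(𝔸) ≃ₜ* Z(γ′)` (lattice clauses `hΛe`, `hΛe′`; Haar matchings `e_*(t_a ⊗ t_b) = νZ`,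
`e′_*(t_a′ ⊗ t_b′) = νZ′`).  If the rank-`N_a` covolumes agree, `vol(U(H_a)(L⁺)∖U(H_a)(𝔸); t_a) = vol(U(H_a′)(L⁺)∖U(H_a′)(𝔸); t_a′)`, and the rank-`N_b`
covolumes agree, then the centraliser covolume weights of (T′) agree:
`vol(U(H)(L⁺) ∩ Z(γ)∖Z(γ); νZ) = vol(U(H)(L⁺) ∩ Z(γ′)∖Z(γ′); νZ′)`.  ★ (K7-s)-SPLIT twice.  (Rogawski's singular frames: `Z(γ_c ⊗ 1) ≅ U(W_c) × L¹`,
`Z(γ_{c′} ⊗ 1) ≅ U(W_{c′}) × L¹`; print supplies the rank-2 identity [Weil1965 n° 54; Kottwitz1988 Prop. 2], the rank-1 factors are the same torus `L¹`.)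
[cite: Rogawski1990, §3.8 Prop. 3.8.1 (a) p. 30; §14.5 Lemma 14.5.2 (b) pp. 238–239] [cite: Weil1965, n° 53 (43) p. 81; n° 54 p. 82] [cite: Gelbart1975, Remark 9.23] -/
theorem covol_centralizer_eq_of_docks
    (ha : quotientMeasure (cmDatum L Na Ha).quotientSubgroup count hqa ta Set.univ =
      quotientMeasure (cmDatum L Na Ha').quotientSubgroup count hqa' ta' Set.univ)
    (hb : quotientMeasure (cmDatum L Nb Hb).quotientSubgroup count hqb tb Set.univ =
      quotientMeasure (cmDatum L Nb Hb').quotientSubgroup count hqb' tb' Set.univ) :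
    quotientMeasure (((cmDatum L N H).quotientSubgroup ⊓ Subgroup.centralizer ({γ} : Set (cmDatum L N H).Adelic)).subgroupOf
        (Subgroup.centralizer ({γ} : Set (cmDatum L N H).Adelic))) count hΛ νZ Set.univ =
      quotientMeasure (((cmDatum L N H).quotientSubgroup ⊓ Subgroup.centralizer ({γ'} : Set (cmDatum L N H).Adelic)).subgroupOf
        (Subgroup.centralizer ({γ'} : Set (cmDatum L N H).Adelic))) count hΛ' νZ' Set.univ := by
  rw [covol_centralizer_eq_mul_of_continuousMulEquiv_prod L H Ha Hb γ hΛ hqa hqb e hΛe ta tb νZ hν,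
    covol_centralizer_eq_mul_of_continuousMulEquiv_prod L H Ha' Hb' γ' hΛ' hqa' hqb' e' hΛe' ta' tb' νZ' hν', ha, hb]

include hqa hqb hqa' hqb' hΛe hΛe' hν hν' in
/-- **(T′) ALONG THE DOCKS, as an equivalence.**  In the situation of `covol_centralizer_eq_of_docks`, if the rank-`N_b` covolumes agree and their common value is
neither `0` nor `∞` (for `U(H_b) = L¹`: a compact quotient of positive finite mass), then the centraliser covolume weights agree IFF the rank-`N_a` covolumes agree —
(T′) at `(c, c′)` is EQUIVALENT to the covolume identity for the hermitian blocks `U(H_a)`, `U(H_a′)` [Weil1965 n° 53 (43): `τ_λ(𝔤) = τ_λ(G)` for the stabiliser `𝔤`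
of an anisotropic vector].  ★ (K7-s)-SPLIT twice and `ENNReal.mul_left_inj`.
[cite: Rogawski1990, §3.8 Prop. 3.8.1 (a) p. 30; §14.5 Lemma 14.5.2 (b) pp. 238–239] [cite: Weil1965, n° 53 (43) p. 81; n° 54 p. 82] [cite: Gelbart1975, Remark 9.23] -/
theorem covol_centralizer_eq_iff_of_docks
    (hb : quotientMeasure (cmDatum L Nb Hb).quotientSubgroup count hqb tb Set.univ =
      quotientMeasure (cmDatum L Nb Hb').quotientSubgroup count hqb' tb' Set.univ)
    (hb0 : quotientMeasure (cmDatum L Nb Hb).quotientSubgroup count hqb tb Set.univ ≠ 0)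
    (hbT : quotientMeasure (cmDatum L Nb Hb).quotientSubgroup count hqb tb Set.univ ≠ ∞) :
    quotientMeasure (((cmDatum L N H).quotientSubgroup ⊓ Subgroup.centralizer ({γ} : Set (cmDatum L N H).Adelic)).subgroupOf
        (Subgroup.centralizer ({γ} : Set (cmDatum L N H).Adelic))) count hΛ νZ Set.univ =
      quotientMeasure (((cmDatum L N H).quotientSubgroup ⊓ Subgroup.centralizer ({γ'} : Set (cmDatum L N H).Adelic)).subgroupOf
        (Subgroup.centralizer ({γ'} : Set (cmDatum L N H).Adelic))) count hΛ' νZ' Set.univ ↔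
    quotientMeasure (cmDatum L Na Ha).quotientSubgroup count hqa ta Set.univ =
      quotientMeasure (cmDatum L Na Ha').quotientSubgroup count hqa' ta' Set.univ := by
  rw [covol_centralizer_eq_mul_of_continuousMulEquiv_prod L H Ha Hb γ hΛ hqa hqb e hΛe ta tb νZ hν,
    covol_centralizer_eq_mul_of_continuousMulEquiv_prod L H Ha' Hb' γ' hΛ' hqa' hqb' e' hΛe' ta' tb' νZ' hν', ← hb]
  exact ENNReal.mul_left_inj hb0 hbT

include hqa hqb hqa' hqb' hΛe hΛe' hν hν' in
/-- **The cancellation read on the other factor.**  In the situation of `covol_centralizer_eq_of_docks`, if the rank-`N_a` covolumes agree with a common value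
neither `0` nor `∞` and the centraliser covolume weights agree, then the rank-`N_b` covolumes agree.  ★ (K7-s)-SPLIT twice and `ENNReal.mul_right_inj`.
[cite: Rogawski1990, §3.8 Prop. 3.8.1 (a) p. 30; §14.5 Lemma 14.5.2 (b) pp. 238–239] [cite: Gelbart1975, Remark 9.23] -/
theorem covol_factor_eq_of_docks
    (ha : quotientMeasure (cmDatum L Na Ha).quotientSubgroup count hqa ta Set.univ =
      quotientMeasure (cmDatum L Na Ha').quotientSubgroup count hqa' ta' Set.univ)
    (ha0 : quotientMeasure (cmDatum L Na Ha).quotientSubgroup count hqa ta Set.univ ≠ 0)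
    (haT : quotientMeasure (cmDatum L Na Ha).quotientSubgroup count hqa ta Set.univ ≠ ∞)
    (hZZ : quotientMeasure (((cmDatum L N H).quotientSubgroup ⊓ Subgroup.centralizer ({γ} : Set (cmDatum L N H).Adelic)).subgroupOf
        (Subgroup.centralizer ({γ} : Set (cmDatum L N H).Adelic))) count hΛ νZ Set.univ =
      quotientMeasure (((cmDatum L N H).quotientSubgroup ⊓ Subgroup.centralizer ({γ'} : Set (cmDatum L N H).Adelic)).subgroupOf
        (Subgroup.centralizer ({γ'} : Set (cmDatum L N H).Adelic))) count hΛ' νZ' Set.univ) :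
    quotientMeasure (cmDatum L Nb Hb).quotientSubgroup count hqb tb Set.univ =
      quotientMeasure (cmDatum L Nb Hb').quotientSubgroup count hqb' tb' Set.univ := by
  rw [covol_centralizer_eq_mul_of_continuousMulEquiv_prod L H Ha Hb γ hΛ hqa hqb e hΛe ta tb νZ hν,
    covol_centralizer_eq_mul_of_continuousMulEquiv_prod L H Ha' Hb' γ' hΛ' hqa' hqb' e' hΛe' ta' tb' νZ' hν', ← ha] at hZZ
  exact (ENNReal.mul_right_inj ha0 haT).mp hZZ

end TwoDocks

end UnitaryGroup

end Literature.NumberTheory.Automorphic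

end
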